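import Summits.NavierStokesRegularity.FunctionalMining.VelocityL4SaturatingLaw
import Summits.NavierStokesRegularity.FunctionalMining.VelocityL6Production
import HarnessLib

/-!
# FunctionalMining — K0 row `EV.s=6|T_LD|G1` HOLDS in the kernel: the saturating law
# `d/dt ∫|u|⁶ ≤ κ ν⁻³ ‖∇u‖₂² (∫|u|⁶)^{4/3}` along classical Navier–Stokes solutions on `T³`

search for candidate a priori estimates; no regularity claim. Cell `pub-nsfunc`, prove seat
(gen 8). HONEST SCOPE: an a priori differential inequality with an EXISTENTIAL constant `κ` (tree
Sobolev and Calderón–Zygmund constants); small-data closing only; nothing about regularity.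

The K0 saturating law (`Candidates.SaturatingLaw F σ γ κ`) for the velocity moment `F = U₆ = ∫|u|⁶`
(`σ = s − 3 = 3`, `γ = 1 + s/σ = 3`): `dU₆/dt ≤ κ ν⁻³ (2ℰ) U₆^{1+1/3}`.

* `velocityL6_saturatingLaw : ∃ κ, SaturatingLaw (fun v => ∫ ‖v‖⁶) 3 3 κ`.

This is the no-go seat's verdict "EV.s=6|T_LD|G1 HOLDS ∃κ" (SIEVELD.md §3.5, paper) as a tree theorem.
PROOF = SIEVELD §3.5 (`s = 6`) with every input a tree theorem: (1) exact `L⁶` balance (RRS 2016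
Ex. 11.4; tree `hasDerivWithinAt_integral_normSq_pow`, `m = 3`): `U̇₆ = −ν(6I₆ + 6∫|u|²∑(∂ₖ|u|²)²)
+ 12∫p|u|²∑ₖuₖ∂ₖ|u|²`, `I₆ = ∫|u|⁴∑ₖ‖∂ₖu‖²`; (2) `12∫p|u|²∑uₖ∂ₖ|u|² = −6∫|u|⁴⟪∇p,u⟫ ≤ 6√A₁₀√∫|∇p|²`
(`VelocityL6Production`); (3) `‖∇p‖₂ ≤ C_p‖(u·∇)u‖₂`, `‖(u·∇)u‖₂² ≤ J`, `J² ≤ I₆Z`; (4)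
`A₁₀³ ≤ U₆²A₁₈`, `A₁₈ ≤ C₁₈I₆³` (`VelocityL6Interpolation`, through the explicit nonlinear
Poincaré inequality `U₆ ≤ 39420d³I₆`); hence `N¹² ≤ (K Z U₆^{4/3} I₆³)³`; (5) Young at `(4, 4/3)`.
[ours; elementary given the cited tree inputs]
-/

noncomputable section

open MeasureTheory Finset Set
open scoped InnerProductSpace RealInnerProductSpace ContDiff

namespace Summit.NavierStokesRegularity.FunctionalMining

open Literature.Analysis.FunctionSpaces Literature.Analysis.FunctionSpaces.Torus
  Literature.Analysis.FluidPDE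

namespace VelocityL6

variable {d : Type*} [Fintype d] [DecidableEq d]

/-! ## 1. Real arithmetic -/

/-- **Exponent bookkeeping of SIEVELD §3.5 (`s = 6`) in polynomial form.** If `N² ≤ c₁A₁₀J`,
`J² ≤ I Z`, `A₁₀³ ≤ U²A₁₈`, `A₁₈ ≤ c₃I³` and `V³ = U⁴` (all non-negative), then
`N⁴ ≤ c₁²(c₃+1) · Z V I³`. [ours; elementary] -/
theorem production6_pow_four_le {N A₁₀ A₁₈ U V Z I J c₁ c₃ : ℝ} (hA : 0 ≤ A₁₀)
    (hV : 0 ≤ V) (hZ : 0 ≤ Z) (hI : 0 ≤ I) (hc₃ : 0 ≤ c₃)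
    (h1 : N ^ 2 ≤ c₁ * A₁₀ * J) (h2 : J ^ 2 ≤ I * Z) (h3 : A₁₀ ^ 3 ≤ U ^ 2 * A₁₈)
    (h4 : A₁₈ ≤ c₃ * I ^ 3) (hVU : V ^ 3 = U ^ 4) :
    N ^ 4 ≤ c₁ ^ 2 * (c₃ + 1) * Z * V * I ^ 3 := by
  have h34 : A₁₀ ^ 3 ≤ U ^ 2 * (c₃ * I ^ 3) := h3.trans (mul_le_mul_of_nonneg_left h4 (by positivity))
  have hA6 : A₁₀ ^ 6 ≤ (U ^ 2 * (c₃ * I ^ 3)) ^ 2 := by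
    rw [show A₁₀ ^ 6 = (A₁₀ ^ 3) ^ 2 by ring]; exact pow_le_pow_left₀ (by positivity) h34 2
  have hJ6 : J ^ 6 ≤ (I * Z) ^ 3 := by
    rw [show J ^ 6 = (J ^ 2) ^ 3 by ring]; exact pow_le_pow_left₀ (by positivity) h2 3
  have h12 : N ^ 12 ≤ (c₁ * A₁₀ * J) ^ 6 := by
    rw [show N ^ 12 = (N ^ 2) ^ 6 by ring]; exact pow_le_pow_left₀ (by positivity) h1 6
  have hc₃' : c₃ ^ 2 ≤ (c₃ + 1) ^ 3 := by nlinarith [sq_nonneg c₃]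
  set K : ℝ := c₁ ^ 2 * (c₃ + 1) with hK
  have hcube : N ^ 12 ≤ (K * Z * V * I ^ 3) ^ 3 := by
    calc N ^ 12 ≤ (c₁ * A₁₀ * J) ^ 6 := h12
      _ = c₁ ^ 6 * A₁₀ ^ 6 * J ^ 6 := by ring
      _ ≤ c₁ ^ 6 * (U ^ 2 * (c₃ * I ^ 3)) ^ 2 * (I * Z) ^ 3 := by gcongr
      _ = c₁ ^ 6 * c₃ ^ 2 * (Z ^ 3 * U ^ 4 * I ^ 9) := by ring
      _ ≤ c₁ ^ 6 * (c₃ + 1) ^ 3 * (Z ^ 3 * U ^ 4 * I ^ 9) := by gcongr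
      _ = (K * Z * V * I ^ 3) ^ 3 := by rw [hK, ← hVU]; ring
  have e : N ^ 12 = (N ^ 4) ^ 3 := by ring
  rw [e] at hcube
  exact le_of_pow_le_pow_left₀ three_ne_zero (by positivity) hcube

/-- **Young / AM–GM at the exponents `(4, 4/3)`**: `N⁴ ≤ x y³` with `N, x, y ≥ 0` gives
`N ≤ x/4 + 3y/4`. [folklore] -/
theorem le_of_pow_four_le {N x y : ℝ} (hN : 0 ≤ N) (hx : 0 ≤ x) (hy : 0 ≤ y)
    (h : N ^ 4 ≤ x * y ^ 3) : N ≤ x / 4 + 3 * y / 4 := by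
  have h4 : N = (N ^ 4) ^ ((4 : ℕ)⁻¹ : ℝ) := (Real.pow_rpow_inv_natCast hN (by norm_num)).symm
  have hmono : (N ^ 4) ^ ((4 : ℕ)⁻¹ : ℝ) ≤ (x * y ^ 3) ^ ((4 : ℕ)⁻¹ : ℝ) :=
    Real.rpow_le_rpow (by positivity) h (by norm_num)
  have hsplit : (x * y ^ 3) ^ ((4 : ℕ)⁻¹ : ℝ) = x ^ (1 / 4 : ℝ) * y ^ (3 / 4 : ℝ) := by
    rw [Real.mul_rpow hx (by positivity)]
    have e1 : ((4 : ℕ)⁻¹ : ℝ) = 1 / 4 := by norm_num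
    rw [e1]
    congr 1
    rw [show y ^ 3 = y ^ ((3 : ℕ) : ℝ) from (Real.rpow_natCast y 3).symm, ← Real.rpow_mul hy]
    norm_num
  have hAG : x ^ (1 / 4 : ℝ) * y ^ (3 / 4 : ℝ) ≤ (1 / 4) * x + (3 / 4) * y :=
    Real.geom_mean_le_arith_mean2_weighted (by norm_num) (by norm_num) hx hy (by norm_num)
  rw [h4]
  calc (N ^ 4) ^ ((4 : ℕ)⁻¹ : ℝ) ≤ (x * y ^ 3) ^ ((4 : ℕ)⁻¹ : ℝ) := hmono
    _ = x ^ (1 / 4 : ℝ) * y ^ (3 / 4 : ℝ) := hsplit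
    _ ≤ (1 / 4) * x + (3 / 4) * y := hAG
    _ = x / 4 + 3 * y / 4 := by ring

/-! ## 2. The `L⁶` balance at a time slice -/

/-- **Slice form of the exact `L⁶` balance** (tree `hasDerivWithinAt_integral_normSq_pow`, `m = 3`,
unforced): along a classical solution on `[a, b] × T^d` with `ν ≥ 0`, `s ↦ ∫‖u(s)‖⁶` is
differentiable within `[a, b]` at `t` and
`d/dt ∫‖u‖⁶ ≤ −6ν ∫‖u‖⁴∑ₖ‖∂ₖu‖² + 6 |∫‖u‖⁴⟪∇p, u⟫|`.
[cite: RobinsonRodrigoSadowski2016, Ch. 11 Exercise 11.4 eq. (11.19)] -/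
theorem derivWithin_integral_norm_pow_six_le {a b ν : ℝ} (hab : a < b) (hν : 0 ≤ ν)
    {u : ℝ → UnitAddTorus d → EuclideanSpace ℝ d} {p : ℝ → UnitAddTorus d → ℝ}
    (hsol : IsClassicalNSSolutionOn (Icc a b) ν 0 u p) {t : ℝ} (ht : t ∈ Icc a b) :
    DifferentiableWithinAt ℝ (fun s => ∫ x, ‖u s x‖ ^ 6) (Icc a b) t ∧
      derivWithin (fun s => ∫ x, ‖u s x‖ ^ 6) (Icc a b) t ≤
        -(6 * ν * ∫ x, ‖u t x‖ ^ 4 * ∑ k, ‖partialDeriv k (u t) x‖ ^ 2) +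
          6 * |∫ x, ‖u t x‖ ^ 4 * ⟪gradient (p t) x, u t x⟫| := by
  have hut : IsSmooth (u t) := hsol.smooth_velocity.isSmooth_slice ht
  have hpt : IsSmooth (p t) := hsol.smooth_pressure.isSmooth_slice ht
  have hdiv : IsDivFree (u t) := hsol.divFree t ht
  have hD := hsol.hasDerivWithinAt_integral_normSq_pow hab 3 ht
  have hF : (fun s => ∫ x, ‖u s x‖ ^ 6) = fun s => ∫ x, (‖u s x‖ ^ 2) ^ 3 := by
    funext s; exact integral_congr_ae (ae_of_all _ fun x => by ring)
  have hUD : UniqueDiffWithinAt ℝ (Icc a b) t := uniqueDiffOn_Icc hab t ht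
  refine ⟨?_, ?_⟩
  · rw [hF]; exact hD.differentiableWithinAt
  rw [hF, hD.derivWithin hUD]
  obtain ⟨I, hI⟩ : ∃ I : ℝ, I = ∫ x, ‖u t x‖ ^ 4 * ∑ k, ‖partialDeriv k (u t) x‖ ^ 2 := ⟨_, rfl⟩
  obtain ⟨I₂, hI₂⟩ : ∃ I₂ : ℝ, I₂ = ∫ x, ‖u t x‖ ^ 2 *
      ∑ k, partialDeriv k (fun y => ‖u t y‖ ^ 2) x ^ 2 := ⟨_, rfl⟩
  obtain ⟨P, hP⟩ : ∃ P : ℝ, P = ∫ x, ‖u t x‖ ^ 4 * ⟪gradient (p t) x, u t x⟫ := ⟨_, rfl⟩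
  have hI₂0 : 0 ≤ I₂ := by
    rw [hI₂]; exact integral_nonneg fun x => mul_nonneg (sq_nonneg _)
      (Finset.sum_nonneg fun k _ => sq_nonneg _)
  have hV1 : ∫ x, (‖u t x‖ ^ 2) ^ (3 - 1) * ∑ k, ‖partialDeriv k (u t) x‖ ^ 2 = I := by
    rw [hI]; refine integral_congr_ae (ae_of_all _ fun x => ?_); simp only; ring
  have hV2 : ∫ x, (‖u t x‖ ^ 2) ^ (3 - 2) *
      ∑ k, partialDeriv k (fun y => ‖u t y‖ ^ 2) x ^ 2 = I₂ := by
    rw [hI₂]; refine integral_congr_ae (ae_of_all _ fun x => ?_); simp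
  have hPt : ∫ x, p t x * ((‖u t x‖ ^ 2) ^ (3 - 2) *
      ∑ k, u t x k * partialDeriv k (fun y => ‖u t y‖ ^ 2) x) = -(1 / 2) * P := by
    have e : ∫ x, p t x * ((‖u t x‖ ^ 2) ^ (3 - 2) *
        ∑ k, u t x k * partialDeriv k (fun y => ‖u t y‖ ^ 2) x) =
        ∫ x, p t x * (‖u t x‖ ^ 2 * ∑ k, u t x k * partialDeriv k (fun y => ‖u t y‖ ^ 2) x) :=
      integral_congr_ae (ae_of_all _ fun x => by simp)
    rw [e, hP]
    exact pressure_term6_eq hut hdiv hpt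
  have hf0 : ∫ x, (‖u t x‖ ^ 2) ^ (3 - 1) *
      ⟪u t x, (0 : ℝ → UnitAddTorus d → EuclideanSpace ℝ d) t x⟫ = 0 := by
    simp
  rw [← hI, ← hP, hV1, hV2, hPt, hf0]
  push_cast
  have hPle : -P ≤ |P| := neg_le_abs P
  have hνI₂ : 0 ≤ ν * I₂ := mul_nonneg hν hI₂0
  nlinarith [hPle, hνI₂]

/-! ## 3. The static production bound -/

/-- **Production bound (static) for `U₆`.** With the tree's constants `C₆` (mean-zero Sobolev)
and `C_p` (`‖∇p‖₂ ≤ C_p‖(u·∇)u‖₂`): for smooth zero-mean `u` and smooth `p`, `N := 6|∫|u|⁴⟪∇p,u⟫|`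
satisfies `N⁴ ≤ K · Z · V · I₆³` for every `V ≥ 0` with `V³ = (∫|u|⁶)⁴`, where
`K = (36C_p²)² (C₁₈+1)`, `C₁₈ = 32(729C₆ + (39420d³)³)`. [ours] -/
theorem production6_bound {C₆ Cp : ℝ} (hC₆0 : 0 ≤ C₆) (hCp0 : 0 ≤ Cp)
    (hC₆ : ∀ v : UnitAddTorus d → EuclideanSpace ℝ d, IsSmooth v → HasZeroMean v →
      ∫ x, ‖v x‖ ^ 6 ≤ C₆ * gradNormSq v ^ 3)
    {u : UnitAddTorus d → EuclideanSpace ℝ d} (hu : IsSmooth u) (h0 : HasZeroMean u)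
    {p : UnitAddTorus d → ℝ} (hp : IsSmooth p)
    (hgrad : Real.sqrt (∫ x, ‖gradient p x‖ ^ 2) ≤
      Cp * Real.sqrt (∫ x, ‖convect u u x‖ ^ 2))
    {V : ℝ} (hV0 : 0 ≤ V) (hVU : V ^ 3 = (∫ x, ‖u x‖ ^ 6) ^ 4) :
    (6 * |∫ x, ‖u x‖ ^ 4 * ⟪gradient p x, u x⟫|) ^ 4 ≤
      (36 * Cp ^ 2) ^ 2 * (32 * (729 * C₆ + (39420 * (Fintype.card d : ℝ) ^ 3) ^ 3) + 1) *
        gradNormSq u * V * (∫ x, ‖u x‖ ^ 4 * ∑ k, ‖partialDeriv k u x‖ ^ 2) ^ 3 := by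
  obtain ⟨I, hI⟩ : ∃ I : ℝ, I = ∫ x, ‖u x‖ ^ 4 * ∑ k, ‖partialDeriv k u x‖ ^ 2 := ⟨_, rfl⟩
  obtain ⟨J, hJ⟩ : ∃ J : ℝ, J = ∫ x, ‖u x‖ ^ 2 * ∑ k, ‖partialDeriv k u x‖ ^ 2 := ⟨_, rfl⟩
  obtain ⟨U, hU⟩ : ∃ U : ℝ, U = ∫ x, ‖u x‖ ^ 6 := ⟨_, rfl⟩
  obtain ⟨Z, hZ⟩ : ∃ Z : ℝ, Z = gradNormSq u := ⟨_, rfl⟩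
  obtain ⟨A₁₀, hA₁₀⟩ : ∃ A : ℝ, A = ∫ x, ‖u x‖ ^ 10 := ⟨_, rfl⟩
  obtain ⟨A₁₈, hA₁₈⟩ : ∃ A : ℝ, A = ∫ x, ‖u x‖ ^ 18 := ⟨_, rfl⟩
  obtain ⟨N, hN⟩ : ∃ N : ℝ, N = 6 * |∫ x, ‖u x‖ ^ 4 * ⟪gradient p x, u x⟫| := ⟨_, rfl⟩
  rw [← hI, ← hZ, ← hN]
  rw [← hU] at hVU
  have huc : Continuous u := hu.continuous
  have hI0 : 0 ≤ I := by rw [hI]; exact integral_nonneg fun x => by positivity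
  have hJ0 : 0 ≤ J := by rw [hJ]; exact integral_nonneg fun x => by positivity
  have hU0 : 0 ≤ U := by rw [hU]; exact integral_nonneg fun x => by positivity
  have hZ0 : 0 ≤ Z := by rw [hZ]; exact gradNormSq_nonneg u
  have hA0 : 0 ≤ A₁₀ := by rw [hA₁₀]; exact integral_nonneg fun x => by positivity
  have hN0 : 0 ≤ N := by rw [hN]; positivity
  have hconv : Real.sqrt (∫ x, ‖convect u u x‖ ^ 2) ≤ Real.sqrt J := by
    rw [hJ]; exact Real.sqrt_le_sqrt (VelocityL4.integral_norm_convect_self_sq_le hu)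
  have hNle : N ≤ 6 * (Real.sqrt A₁₀ * (Cp * Real.sqrt J)) := by
    have h := abs_pressure_term6_le hu hp
    rw [← hA₁₀] at h
    rw [hN]
    calc 6 * |∫ x, ‖u x‖ ^ 4 * ⟪gradient p x, u x⟫|
        ≤ 6 * (Real.sqrt A₁₀ * Real.sqrt (∫ x, ‖gradient p x‖ ^ 2)) := by gcongr
      _ ≤ 6 * (Real.sqrt A₁₀ * (Cp * Real.sqrt J)) := by
          gcongr
          exact hgrad.trans (mul_le_mul_of_nonneg_left hconv hCp0)
  have h1 : N ^ 2 ≤ 36 * Cp ^ 2 * A₁₀ * J := by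
    have hs := pow_le_pow_left₀ hN0 hNle 2
    have eA := Real.sq_sqrt hA0
    have eJ := Real.sq_sqrt hJ0
    calc N ^ 2 ≤ (6 * (Real.sqrt A₁₀ * (Cp * Real.sqrt J))) ^ 2 := hs
      _ = 36 * Cp ^ 2 * (Real.sqrt A₁₀ ^ 2) * (Real.sqrt J ^ 2) := by ring
      _ = 36 * Cp ^ 2 * A₁₀ * J := by rw [eA, eJ]
  have h2 : J ^ 2 ≤ I * Z := by
    rw [hJ, hI, hZ]; exact integral_weighted_sq_le hu
  have h3 : A₁₀ ^ 3 ≤ U ^ 2 * A₁₈ := by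
    rw [hA₁₀, hU, hA₁₈]; exact integral_norm_pow_ten_pow_three_le huc
  have h4 : A₁₈ ≤ 32 * (729 * C₆ + (39420 * (Fintype.card d : ℝ) ^ 3) ^ 3) * I ^ 3 := by
    rw [hA₁₈, hI]; exact integral_norm_pow_eighteen_le hC₆0 hC₆ hu h0
  exact production6_pow_four_le hA0 hV0 hZ0 hI0 (by positivity) h1 h2 h3 h4 hVU

/-! ## 4. The saturating law -/

/-- **K0 row `EV.s=6|T_LD|G1` HOLDS (∃κ), in the kernel.** There is a constant `κ` such that along
every zero-mean classical solution of the unforced Navier–Stokes equations on `T³` (`ν > 0`), at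
every time of the window, `s ↦ ∫‖u(s)‖⁶` is differentiable within the window and
`d/dt ∫‖u‖⁶ ≤ κ · ν^{−3} · ‖∇u‖₂² · (∫‖u‖⁶)^{4/3}` — the cell's saturating law `T_LD` with
`σ = 3`, `γ = 3` for the velocity moment `U₆` (`Candidates.SaturatingLaw`). Existential constant; an
a priori inequality, small-data closing only.
[ours; chain of SIEVELD §3.5 (`s = 6`) with tree inputs, cf. RobinsonRodrigoSadowski2016 Ex. 11.4–11.7] -/
theorem velocityL6_saturatingLaw :
    ∃ κ : ℝ, SaturatingLaw (d := d) (fun v => ∫ x, ‖v x‖ ^ 6) 3 3 κ := by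
  classical
  by_cases hd : Fintype.card d = 3
  swap
  · exact ⟨0, fun h => absurd h hd⟩
  haveI : Nonempty d := Fintype.card_pos_iff.mp (by omega)
  obtain ⟨C₆, hC₆0, hC₆⟩ := Torus.exists_integral_norm_pow_six_le_gradNormSq_cube (d := d) hd
  obtain ⟨Cp, hCp0, hCp⟩ := Torus.exists_gradPressure_Ls_le_convect (d := d) (r := 2) one_lt_two
  obtain ⟨K, hK⟩ : ∃ K : ℝ, K = (36 * Cp ^ 2) ^ 2 *
      (32 * (729 * C₆ + (39420 * (Fintype.card d : ℝ) ^ 3) ^ 3) + 1) := ⟨_, rfl⟩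
  have hK0 : 0 ≤ K := by rw [hK]; positivity
  refine ⟨K / 864, ?_⟩
  intro _ ν hν a b hab u p hsol hmean t ht
  have hut : IsSmooth (u t) := hsol.smooth_velocity.isSmooth_slice ht
  have hpt : IsSmooth (p t) := hsol.smooth_pressure.isSmooth_slice ht
  have h0 : HasZeroMean (u t) := hmean t ht
  obtain ⟨hdiff, hle⟩ := derivWithin_integral_norm_pow_six_le hab hν.le hsol ht
  refine ⟨hdiff, ?_⟩
  show _ ≤ K / 864 * ν ^ (-(3 : ℝ)) * (2 * torusEnstrophy (u t)) *
      (∫ x, ‖u t x‖ ^ 6) ^ (1 + (3 : ℝ)⁻¹)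
  obtain ⟨I, hI⟩ : ∃ I : ℝ, I = ∫ x, ‖u t x‖ ^ 4 * ∑ k, ‖partialDeriv k (u t) x‖ ^ 2 := ⟨_, rfl⟩
  obtain ⟨U, hU⟩ : ∃ U : ℝ, U = ∫ x, ‖u t x‖ ^ 6 := ⟨_, rfl⟩
  obtain ⟨Z, hZ⟩ : ∃ Z : ℝ, Z = gradNormSq (u t) := ⟨_, rfl⟩
  obtain ⟨P, hP⟩ : ∃ P : ℝ, P = ∫ x, ‖u t x‖ ^ 4 * ⟪gradient (p t) x, u t x⟫ := ⟨_, rfl⟩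
  obtain ⟨V, hV⟩ : ∃ V : ℝ, V = U ^ (1 + (3 : ℝ)⁻¹) := ⟨_, rfl⟩
  rw [← hI, ← hP] at hle
  rw [← hU, ← hV]
  have hI0 : 0 ≤ I := by rw [hI]; exact integral_nonneg fun x => by positivity
  have hU0 : 0 ≤ U := by rw [hU]; exact integral_nonneg fun x => by positivity
  have hZ0 : 0 ≤ Z := by rw [hZ]; exact gradNormSq_nonneg _
  have hV0 : 0 ≤ V := by rw [hV]; exact Real.rpow_nonneg hU0 _
  have hVU : V ^ 3 = U ^ 4 := by
    rw [hV, ← Real.rpow_natCast (U ^ ((1 : ℝ) + (3 : ℝ)⁻¹)) 3, ← Real.rpow_mul hU0,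
      show ((1 : ℝ) + (3 : ℝ)⁻¹) * ((3 : ℕ) : ℝ) = ((4 : ℕ) : ℝ) by norm_num, Real.rpow_natCast]
  have hgrad : Real.sqrt (∫ x, ‖gradient (p t) x‖ ^ 2) ≤
      Cp * Real.sqrt (∫ x, ‖convect (u t) (u t) x‖ ^ 2) :=
    VelocityL4.sqrt_integral_sq_le_of_rpow (f := fun x => ‖gradient (p t) x‖)
      (g := fun x => ‖convect (u t) (u t) x‖) (hCp hab hsol t ht)
  have h4 : (6 * |P|) ^ 4 ≤ K * Z * V * I ^ 3 := by
    rw [hK, hZ, hI, hP]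
    have hVU' : V ^ 3 = (∫ x, ‖u t x‖ ^ 6) ^ 4 := by rw [hVU, hU]
    exact production6_bound hC₆0 hCp0 hC₆ hut h0 hpt hgrad hV0 hVU'
  -- Young: `6|P| ≤ x/4 + 3y/4`, `x = K Z V/(216 ν³)`, `y = 6νI`
  obtain ⟨x, hx⟩ : ∃ x : ℝ, x = K * Z * V / (216 * ν ^ 3) := ⟨_, rfl⟩
  obtain ⟨y, hy⟩ : ∃ y : ℝ, y = 6 * ν * I := ⟨_, rfl⟩
  have hx0 : 0 ≤ x := by rw [hx]; positivity
  have hy0 : 0 ≤ y := by rw [hy]; positivity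
  have hxy : x * y ^ 3 = K * Z * V * I ^ 3 := by
    rw [hx, hy]; field_simp; ring
  have hNle : 6 * |P| ≤ x / 4 + 3 * y / 4 :=
    le_of_pow_four_le (by positivity) hx0 hy0 (by rw [hxy]; exact h4)
  have hbudget : K / 864 * ν ^ (-(3 : ℝ)) * (2 * torusEnstrophy (u t)) * V =
      K * Z * V / (864 * ν ^ 3) := by
    have e1 : ν ^ (-(3 : ℝ)) = (ν ^ 3)⁻¹ := by
      rw [Real.rpow_neg hν.le, show (3 : ℝ) = ((3 : ℕ) : ℝ) by norm_num, Real.rpow_natCast]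
    have e3 : 2 * torusEnstrophy (u t) = Z := by
      rw [hZ, torusEnstrophy]; ring
    rw [e1, e3]
    field_simp
  rw [hbudget]
  have hxI : x / 4 + 3 * y / 4 = K * Z * V / (864 * ν ^ 3) + 9 / 2 * ν * I := by
    rw [hx, hy]; ring
  have hνI : 0 ≤ ν * I := mul_nonneg hν.le hI0
  linarith [hNle, hxI, hνI, hle]

end VelocityL6

end Summit.NavierStokesRegularity.FunctionalMining
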